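import Summits.BirchSwinnertonDyer.Rank1Residual.X2.HidaLimitCongruenceAlgebra
import Mathlib.RingTheory.PowerSeries.Ideal
import HarnessLib

/-!
# Route `SemiOrdinaryEisensteinDescent`, crux E `WildSplitEisensteinInclusionAtThree` (stmt-BirchSwinnertonDyer-20479),
# registered stub `stub_saturate`: SATURATION in `R₀⟦T⟧` at the prime `3` — a unit coefficient of `L` and
# `3^k·I ⊆ (L)` force `I ⊆ (L)` (pure algebra; seat `bsd-wall-utd-p3` gen 1, `--supports 20479`)

`R₀ = unrIntegers 3 ⊂ ℂ₃` (Castella's `W(𝔽̄₃)^∧`) is a discrete valuation ring with uniformizer `3`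
(tree: `HidaLimitAlgebra.isDiscreteValuationRing_unrIntegers`, `HidaLimitAlgebra.irreducible_natCast_p`), so `3`
is PRIME in `R₀` and `k := R₀/3R₀` is a domain, hence so is `k⟦T⟧`. If `L ∈ R₀⟦T⟧` has a unit coefficient
then `L mod 3 ≠ 0` in `k⟦T⟧`; so from `3^{k+1}·x = L·y` we get `(L mod 3)·(y mod 3) = 0`, `y ≡ 0 (mod 3)`,
`y = 3·y′`, and cancelling `3` in the domain `R₀⟦T⟧` gives `3^k·x = L·y′`; induction on `k`. Nothing about
elliptic curves; no named fact; no `sorry`.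

* `mem_span_of_pow_three_mul_mem_span` — the element form: `3^k·x ∈ (L) ⇒ x ∈ (L)`.
* `stub_saturate` — the registered signature VERBATIM (skeleton sha16 4d547c0373835491 of pss3 g4).

References: [Washington1997] §7.1 (structure of `𝒪⟦T⟧`); [Castella2018] §3 (the receptacle `R₀⟦T⟧`).
-/

set_option autoImplicit false
set_option linter.dupNamespace false

noncomputable section

open scoped Classical

namespace Summit.BirchSwinnertonDyer.BirchSwinnertonDyer.Theorems.WildSplitEisensteinInclusionAtThreeSaturate

open PowerSeries Literature.NumberTheory.EllipticCurves
  Summit.BirchSwinnertonDyer.Rank1Residual.X2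

/-- `3` is prime in `R₀ = unrIntegers 3` (the uniformizer of the DVR `W(𝔽̄₃)^∧`). [folklore] -/
theorem prime_three_unrIntegers : Prime (3 : unrIntegers 3) := by
  haveI := HidaLimitAlgebra.isDiscreteValuationRing_unrIntegers (p := 3)
  have h : Prime ((3 : ℕ) : unrIntegers 3) :=
    UniqueFactorizationMonoid.irreducible_iff_prime.mp HidaLimitAlgebra.irreducible_natCast_p
  simpa using h

/-- **Saturation at `3` in `R₀⟦T⟧`, element form**: if `L` has a unit coefficient and `3^k·x ∈ (L)` then
`x ∈ (L)`. Reduction modulo the prime `3` of `R₀`: `k⟦T⟧` is a domain and `L mod 3 ≠ 0`. [folklore] -/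
theorem mem_span_of_pow_three_mul_mem_span (L : UnrSeries 3) (hL : ∃ n : ℕ, IsUnit (PowerSeries.coeff n L))
    (k : ℕ) (x : UnrSeries 3) (hx : (3 : UnrSeries 3) ^ k * x ∈ Ideal.span {L}) :
    x ∈ Ideal.span {L} := by
  -- the residue ring `k = R₀/3` and the reduction map on power series
  set P : Ideal (unrIntegers 3) := Ideal.span {(3 : unrIntegers 3)} with hPdef
  have h3P : Prime (3 : unrIntegers 3) := prime_three_unrIntegers
  haveI hPprime : P.IsPrime := (Ideal.span_singleton_prime h3P.ne_zero).mpr h3P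
  haveI : IsDomain (unrIntegers 3 ⧸ P) := (Ideal.Quotient.isDomain_iff_prime P).mpr hPprime
  set φ : unrIntegers 3 →+* unrIntegers 3 ⧸ P := Ideal.Quotient.mk P with hφdef
  have hφ3 : φ 3 = 0 := by
    rw [hφdef, Ideal.Quotient.eq_zero_iff_mem, hPdef]
    exact Ideal.mem_span_singleton_self _
  -- `L mod 3 ≠ 0`
  have hLbar : PowerSeries.map φ L ≠ 0 := by
    obtain ⟨n, hn⟩ := hL
    intro h0
    have h1 : PowerSeries.coeff n (PowerSeries.map φ L) = 0 := by rw [h0, map_zero]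
    rw [PowerSeries.coeff_map] at h1
    have hu : IsUnit (φ (PowerSeries.coeff n L)) := hn.map φ
    rw [h1] at hu
    exact not_isUnit_zero hu
  -- `(3 : R₀⟦T⟧) = C 3`
  have h3C : (3 : UnrSeries 3) = PowerSeries.C (3 : unrIntegers 3) := by
    rw [map_ofNat]
  -- induction on `k`
  induction k generalizing x with
  | zero => simpa using hx
  | succ k ih =>
    obtain ⟨y, hy⟩ := Ideal.mem_span_singleton'.mp hx
    -- reduce `y * L = 3^(k+1) * x` modulo `3`: `ȳ · L̄ = 0`, hence `ȳ = 0`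
    have hybar : PowerSeries.map φ y = 0 := by
      have h := congrArg (PowerSeries.map φ) hy
      rw [map_mul, map_mul, map_pow, h3C, PowerSeries.map_C, hφ3, map_zero, zero_pow (Nat.succ_ne_zero k),
        zero_mul] at h
      exact (mul_eq_zero.mp h).resolve_right hLbar
    -- so every coefficient of `y` is divisible by `3`: `y = C 3 * y'`
    have hdvd : ∀ m : ℕ, (3 : unrIntegers 3) ∣ PowerSeries.coeff m y := by
      intro m
      have hm : φ (PowerSeries.coeff m y) = 0 := by
        rw [← PowerSeries.coeff_map, hybar, map_zero]
      rw [hφdef, Ideal.Quotient.eq_zero_iff_mem, hPdef, Ideal.mem_span_singleton] at hm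
      exact hm
    choose c hc using hdvd
    set y' : UnrSeries 3 := PowerSeries.mk c with hy'def
    have hyC : y = PowerSeries.C (3 : unrIntegers 3) * y' := by
      refine PowerSeries.ext fun m ↦ ?_
      rw [PowerSeries.coeff_C_mul, hy'def, PowerSeries.coeff_mk]
      exact hc m
    -- cancel `C 3` in the domain `R₀⟦T⟧`
    have hC0 : (PowerSeries.C (3 : unrIntegers 3) : UnrSeries 3) ≠ 0 := by
      intro h
      exact h3P.ne_zero (by simpa using congrArg (PowerSeries.coeff 0) h)
    have hk : (3 : UnrSeries 3) ^ k * x = y' * L := by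
      have h := hy
      rw [hyC, pow_succ, h3C, mul_assoc, mul_comm (_ ^ k) (PowerSeries.C _), mul_assoc] at h
      exact (mul_left_cancel₀ hC0 h).symm
    exact ih x (Ideal.mem_span_singleton'.mpr ⟨y', hk.symm⟩)

/-- **Registered stub `stub_saturate` of crux E `WildSplitEisensteinInclusionAtThree` (item 20479, skeleton
sha16 4d547c0373835491), signature VERBATIM**: for an ideal `I` of `R₀⟦T⟧` and `L ∈ R₀⟦T⟧` with a unit
coefficient, if `3^k·I ⊆ (L)` for some `k` then `I ⊆ (L)`. The pure-algebra step that upgrades an inclusion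
`Ch·R₀⟦T⟧ ⊆ (L)` known up to a power of `3` (a rational / `⊗ℚ₃` statement) to the integral inclusion when `L`
has `μ = 0`. [folklore] -/
theorem stub_saturate :
    ∀ (I : Ideal (Literature.NumberTheory.EllipticCurves.UnrSeries 3)) (L : Literature.NumberTheory.EllipticCurves.UnrSeries 3), (∃ n : ℕ, IsUnit (PowerSeries.coeff n L)) → (∃ k : ℕ, ∀ x ∈ I, (3 : Literature.NumberTheory.EllipticCurves.UnrSeries 3) ^ k * x ∈ Ideal.span {L}) → I ≤ Ideal.span {L} := by
  intro I L hL hk x hx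
  obtain ⟨k, hk⟩ := hk
  exact mem_span_of_pow_three_mul_mem_span L hL k x (hk x hx)

end Summit.BirchSwinnertonDyer.BirchSwinnertonDyer.Theorems.WildSplitEisensteinInclusionAtThreeSaturate

end
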